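import Summits.QuantumFields.BalabanUV.T4Continuum.Support.AveragingDeficitNearIdentity
import Literature.Analysis.Calculus.ExpDuhamel

/-!
# AveragingDeficitSideDeriv (T⁴ programme, node NE3, row NE3-R2) — the derivative of ONE averaged bond variable
# `V̄(c) = e^{X_c} V(c)` of B7 (42) along `V e^{sψ}`: the Duhamel loop identity for `d/ds log[V_s(Γ_{c,x})V_s(c)⁻¹]`,
# the left-trivialised derivative `δV̄(c) = Ad_{e^{X_c}}(J_{X_c}(X_c′) + (δ_ψV)(Γ_c))`, and its distance
# `O(w)·(averaged loop weights)` from the LINEARISED derivative `Σ_x L^{−d}(δ_ψV)(loop_{c,x}) + (δ_ψV)(Γ_c)`,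
# `w = max_x |V(Γ_{c,x})V(c)⁻¹ − 1|` (layer (DL), part 1: one side)

HONEST FRAMING (cell `pub-balaban`; unit `b2b-balaban-t4-ne3r2-p1`, owner of BINDER-OWNERS row NE3-R2 whose exit binder is
β = `T4AveragingDeficitWall.DeficitDerivWall`).  This file does NOT prove β; it is a layer of this unit's programme
β ⇐ CoarseCore (`AveragingDeficitDerivCore/Assembly`) ⇐ (W) ∧ (DL) ∧ (M).  Everything is [folklore] matrix calculus on
the tree's transcriptions of (42) (`B7Prop1Explicit.Wcx/Xavg/bavg`), using the tree's d-exp Duhamel formula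
`Literature.Analysis.Calculus.ExpDuhamel.hasDerivAt_exp_comp` (Hall 2015, Thm 5.4); the `[cite:]` tags name (42) as CONTEXT;
no printed sentence is a hypothesis; NE3 stays COND-free; finite-T⁴ rung (B)+1, NOT Clay / mass gap / summit progress.

WHAT IS PROVED.  §1 `jexp X Y = ∫₀¹ e^{−rX} Y e^{rX} dr`, `norm_jexp_sub_le` (`‖J_X(Y) − Y‖ ≤ 15‖X‖‖Y‖`, `‖X‖ ≤ 1`),
`norm_jexp_le`, `hasDerivAt_exp_comp_jexp`.  §2 the loop variable `W = V(Γ_{c,x})V(c)⁻¹`: `loopWord`,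
`hasDerivAt_val_Wcx_vary'` (`d/ds W_s = (δ_ψV)(loop)·W`), `mlogDeriv` (the derivative of `log W_s` at `0`, as `deriv`),
`hasDerivAt_mlog_Wcx_vary`, **`jexp_mlog_eq_Ad`** (THE LOOP IDENTITY `J_{log W}((log W_s)′) = Ad_{W⁻¹}(δ_ψV)(loop)`:
Duhamel + `exp ∘ log = id` near `s = 0` + uniqueness of derivatives), **`norm_mlogDeriv_sub_le`**
(`‖(log W_s)′‖ ≤ 16‖δ loop‖`, `‖(log W_s)′ − δ loop‖ ≤ 482·‖W − 1‖·‖δ loop‖` for unitary data with `‖W − 1‖ ≤ 1/32`).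
§3 the side: `XavgDeriv`, `hasDerivAt_Xavg_vary`, `sideDeriv := Ad_{e^{X}}(J_X(X′) + (δ_ψV)(Γ_c))`,
**`hasDerivAt_val_bavg_vary : d/ds|₀ V̄_s(c) = sideDeriv · V̄(c)`**, `Xavg_mem_skewAdjoint`, norm bounds: `sideDerivLin := Σ_x L^{−d}(δ_ψV)(loop_{c,x}) + (δ_ψV)(Γ_c)`, **`norm_sideDeriv_sub_lin_le`**
(`‖sideDeriv − sideDerivLin‖ ≤ 1250·w·(Σ_x L^{−d}‖δ loop_{c,x}‖ + ‖δΓ_c‖)`), `norm_sideDeriv_le`.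
Record: HOME `t4/T4-EST-NE3-R2.md`.  PLACEMENT: `Summits/QuantumFields/BalabanUV/` (human rule 2026-08-19).
-/

set_option autoImplicit false

open scoped BigOperators Matrix Matrix.Norms.L2Operator Topology
open NormedSpace Finset Filter

namespace Summit.QuantumFields.BalabanUV.T4Continuum.AveragingDeficitSideDeriv

open Literature.MathematicalPhysics.QuantumFieldTheory.Balaban1983to89
open B7Prop1Explicit B7Prop2Explicit MatrixLog UnitaryModel
open T4AveragingDeficitWall hiding Site Plane Plaq Bond
open T4AveragingDeficitNonAbelian (Ad_mul Ad_sub)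
open AveragingDeficitTransport AveragingDeficitLocality AveragingDeficitNearIdentity
open Literature.Analysis.Calculus (hasDerivAt_exp_comp norm_integral_conj_exp_sub_le norm_integral_conj_exp_le)

noncomputable section

variable {d : ℕ} {n : Type*} [Fintype n] [DecidableEq n]

local notation "𝕄" => Matrix n n ℂ
local notation "Site" => B7Prop1Explicit.Site

/-! ## §1 The right-trivialised differential of `exp`: `J_X(Y) = ∫₀¹ e^{−rX} Y e^{rX} dr` -/

/-- `J_X(Y) := ∫₀¹ e^{−rX} Y e^{rX} dr`, so that `d/ds e^{X_s} = e^{X} J_X(X′)` (Hall 2015 Thm 5.4 via the tree's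
`ExpDuhamel`). [folklore] -/
def jexp (X Y : 𝕄) : 𝕄 := ∫ r in (0 : ℝ)..1, exp (-(r • X)) * Y * exp (r • X)

/-- `‖J_X(Y) − Y‖ ≤ 15‖X‖‖Y‖` for `‖X‖ ≤ 1`. [folklore] -/
theorem norm_jexp_sub_le (X Y : 𝕄) (hX : ‖X‖ ≤ 1) : ‖jexp X Y - Y‖ ≤ 15 * ‖X‖ * ‖Y‖ := by
  letI : NormedAlgebra ℚ 𝕄 := NormedAlgebra.restrictScalars ℚ ℝ 𝕄
  exact norm_integral_conj_exp_sub_le X Y hX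

/-- `‖J_X(Y)‖ ≤ e^{2‖X‖}‖Y‖`. [folklore] -/
theorem norm_jexp_le (X Y : 𝕄) : ‖jexp X Y‖ ≤ Real.exp (2 * ‖X‖) * ‖Y‖ := by
  letI : NormedAlgebra ℚ 𝕄 := NormedAlgebra.restrictScalars ℚ ℝ 𝕄
  exact norm_integral_conj_exp_le X Y

/-- `d/ds e^{γ(s)} = e^{γ(0)} J_{γ(0)}(γ′)` at `s = 0`. [folklore] -/
theorem hasDerivAt_exp_comp_jexp {γ : ℝ → 𝕄} {γ' : 𝕄} (h : HasDerivAt γ γ' 0) :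
    HasDerivAt (fun s => exp (γ s)) (exp (γ 0) * jexp (γ 0) γ') 0 := by
  letI : NormedAlgebra ℚ 𝕄 := NormedAlgebra.restrictScalars ℚ ℝ 𝕄
  have := hasDerivAt_exp_comp h
  simpa only [jexp, mul_assoc] using this

/-! ## §2 The loop variable `W_{c,x} = V(Γ_{c,x})V(c)⁻¹` of (42) along `V e^{sψ}` -/

/-- The closed loop `Γ_{c,x} ∪ (−Γ_c)` of (42) as a word from `c₋ = q`. [cite: Balaban1985Averaging, (42) p.23] -/
def loopWord (L : ℕ) (κ : Fin d) (r : Site d) : List (Letter d) := gammaWord L κ r ++ seg κ (-(L : ℤ))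

/-- `|loop| = 2|r|₁ + 2L`. [folklore] -/
theorem length_loopWord (L : ℕ) (κ : Fin d) (r : Site d) : (loopWord L κ r).length = 2 * l1 r + 2 * L := by
  simp only [loopWord, List.length_append, length_gammaWord, length_seg, Int.natAbs_neg, Int.natAbs_natCast]
  ring

/-- **`d/ds|₀ W_s = (δ_ψV)(loop)·W`** for the loop variable of (42). [cite: Balaban1985Averaging, (42) p.23] -/
theorem hasDerivAt_val_Wcx_vary' (L : ℕ) (V : Site d → Fin d → 𝕄ˣ) (ψ : Site d → Fin d → 𝕄) (q : Site d)
    (κ : Fin d) (r : Site d) :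
    HasDerivAt (fun s : ℝ => ((Wcx L (vary V ψ s) q κ r : 𝕄ˣ) : 𝕄))
      (dhol V ψ q (loopWord L κ r) * ((Wcx L V q κ r : 𝕄ˣ) : 𝕄)) 0 := by
  have h := hasDerivAt_val_hol_vary_word V ψ (loopWord L κ r) q
  simp only [loopWord, ← Wcx_eq_hol_loop] at h
  exact h

/-- The derivative of `s ↦ log W_s` at `0` (as `deriv`; it exists inside the ball `|W − 1| < 1`). [folklore] -/
def mlogDeriv (L : ℕ) (V : Site d → Fin d → 𝕄ˣ) (ψ : Site d → Fin d → 𝕄) (q : Site d) (κ : Fin d)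
    (r : Site d) : 𝕄 :=
  deriv (fun s : ℝ => mlog ((Wcx L (vary V ψ s) q κ r : 𝕄ˣ) : 𝕄)) 0

/-- `s ↦ log W_s` has derivative `mlogDeriv` at `0` inside the ball. [cite: Balaban1985Averaging, (21) p.21, (42) p.23] -/
theorem hasDerivAt_mlog_Wcx_vary (L : ℕ) (V : Site d → Fin d → 𝕄ˣ) (ψ : Site d → Fin d → 𝕄) (q : Site d)
    (κ : Fin d) (r : Fin d → Fin L) (hW : ‖((Wcx L V q κ (boxVec L r) : 𝕄ˣ) : 𝕄) - 1‖ < 1) :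
    HasDerivAt (fun s : ℝ => mlog ((Wcx L (vary V ψ s) q κ (boxVec L r) : 𝕄ˣ) : 𝕄))
      (mlogDeriv L V ψ q κ (boxVec L r)) 0 :=
  (differentiableAt_mlog_Wcx_vary L V ψ q κ (boxVec L r) hW).hasDerivAt

/-- Near `s = 0` the loop variable stays in the ball `|W_s − 1| < 1` (continuity). [folklore] -/
theorem eventually_norm_Wcx_vary_sub_one_lt (L : ℕ) (V : Site d → Fin d → 𝕄ˣ) (ψ : Site d → Fin d → 𝕄)
    (q : Site d) (κ : Fin d) (r : Site d) {ρ : ℝ} (hW : ‖((Wcx L V q κ r : 𝕄ˣ) : 𝕄) - 1‖ < ρ) :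
    ∀ᶠ s in 𝓝 (0 : ℝ), ‖((Wcx L (vary V ψ s) q κ r : 𝕄ˣ) : 𝕄) - 1‖ < ρ := by
  have hc : ContinuousAt (fun s : ℝ => ‖((Wcx L (vary V ψ s) q κ r : 𝕄ˣ) : 𝕄) - 1‖) 0 :=
    ((differentiableAt_val_Wcx_vary L V ψ q κ r 0).continuousAt.sub continuousAt_const).norm
  have h := hc.eventually (gt_mem_nhds (a := ρ) (by simpa using hW))
  exact h

/-- **THE LOOP IDENTITY**: `J_{log W}((log W_s)′|₀) = Ad_{W⁻¹} (δ_ψV)(loop)` — both `e^{log W_s}` (Duhamel) and `W_s`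
(transport) differentiate the same function near `0`. [cite: Balaban1985Averaging, (21) p.21, (42) p.23] -/
theorem jexp_mlog_eq_Ad (L : ℕ) (V : Site d → Fin d → 𝕄ˣ) (ψ : Site d → Fin d → 𝕄) (q : Site d) (κ : Fin d)
    (r : Fin d → Fin L) (hW : ‖((Wcx L V q κ (boxVec L r) : 𝕄ˣ) : 𝕄) - 1‖ < 1) :
    jexp (mlog ((Wcx L V q κ (boxVec L r) : 𝕄ˣ) : 𝕄)) (mlogDeriv L V ψ q κ (boxVec L r))
      = Ad (Wcx L V q κ (boxVec L r))⁻¹ (dhol V ψ q (loopWord L κ (boxVec L r))) := by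
  set W₀ : 𝕄ˣ := Wcx L V q κ (boxVec L r) with hW₀
  have hZ := hasDerivAt_mlog_Wcx_vary L V ψ q κ r hW
  -- Duhamel for `exp ∘ log W_s`
  have h1 := hasDerivAt_exp_comp_jexp hZ
  simp only [vary_zero] at h1
  rw [exp_mlog hW] at h1
  -- `exp (log W_s) = W_s` near `0`
  have h2 : HasDerivAt (fun s : ℝ => exp (mlog ((Wcx L (vary V ψ s) q κ (boxVec L r) : 𝕄ˣ) : 𝕄)))
      (dhol V ψ q (loopWord L κ (boxVec L r)) * (W₀ : 𝕄)) 0 := by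
    refine (hasDerivAt_val_Wcx_vary' L V ψ q κ (boxVec L r)).congr_of_eventuallyEq ?_
    exact (eventually_norm_Wcx_vary_sub_one_lt L V ψ q κ (boxVec L r) hW).mono fun s hs => exp_mlog hs
  have h := h1.unique h2
  -- cancel `W₀`
  have h' : jexp (mlog (W₀ : 𝕄)) (mlogDeriv L V ψ q κ (boxVec L r))
      = ((W₀⁻¹ : 𝕄ˣ) : 𝕄) * (dhol V ψ q (loopWord L κ (boxVec L r)) * (W₀ : 𝕄)) := by
    rw [← h, ← mul_assoc, Units.inv_mul, one_mul]
  rw [h']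
  unfold Ad
  rw [inv_inv, mul_assoc]

/-- Real bookkeeping for `norm_mlogDeriv_sub_le`. [folklore] -/
private theorem mlogDeriv_aux {z w Z M D E : ℝ} (hZ : 0 ≤ Z) (hw : 0 ≤ w) (hzw : z ≤ 2 * w)
    (hw32 : w ≤ 1 / 32) (hZle : Z ≤ M + D) (hD : D ≤ 15 * z * Z) (hE : E ≤ 2 * w * M) :
    Z ≤ 16 * M ∧ D + E ≤ 482 * w * M := by
  have hz : z ≤ 1 / 16 := by linarith
  have h1 : 15 * z * Z ≤ 15 * (1 / 16) * Z := mul_le_mul_of_nonneg_right (mul_le_mul_of_nonneg_left hz (by norm_num)) hZ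
  have hZ16 : Z ≤ 16 * M := by linarith
  have h2 : 15 * z * Z ≤ 15 * (2 * w) * (16 * M) :=
    mul_le_mul (mul_le_mul_of_nonneg_left hzw (by norm_num)) hZ16 hZ (by linarith)
  exact ⟨hZ16, by linarith⟩

/-- **`‖(log W_s)′‖ ≤ 16‖δ loop‖` and `‖(log W_s)′ − δ loop‖ ≤ 482‖W − 1‖‖δ loop‖`** on `U(N)` data with `‖W − 1‖ ≤ 1/32`.
[folklore] -/
theorem norm_mlogDeriv_sub_le [Nonempty n] (L : ℕ) {V : Site d → Fin d → 𝕄ˣ} (hV : IsUnitaryCfg V)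
    (ψ : Site d → Fin d → 𝕄) (q : Site d) (κ : Fin d) (r : Fin d → Fin L)
    (hW : ‖((Wcx L V q κ (boxVec L r) : 𝕄ˣ) : 𝕄) - 1‖ ≤ 1 / 32) :
    ‖mlogDeriv L V ψ q κ (boxVec L r)‖ ≤ 16 * ‖dhol V ψ q (loopWord L κ (boxVec L r))‖ ∧
    ‖mlogDeriv L V ψ q κ (boxVec L r) - dhol V ψ q (loopWord L κ (boxVec L r))‖
      ≤ 482 * ‖((Wcx L V q κ (boxVec L r) : 𝕄ˣ) : 𝕄) - 1‖ * ‖dhol V ψ q (loopWord L κ (boxVec L r))‖ := by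
  -- names for the players (opaque to the arithmetic)
  generalize hWg : Wcx L V q κ (boxVec L r) = W₀ at hW
  generalize hZg : mlogDeriv L V ψ q κ (boxVec L r) = Z'
  generalize hMg : dhol V ψ q (loopWord L κ (boxVec L r)) = M
  have hid : jexp (mlog (W₀ : 𝕄)) Z' = Ad W₀⁻¹ M := by
    rw [← hWg, ← hZg, ← hMg]
    exact jexp_mlog_eq_Ad L V ψ q κ r (by rw [hWg]; linarith)
  have hWu : W₀ ∈ unitaryUnits 𝕄 := by
    rw [← hWg]; unfold Wcx; exact mul_mem (hol_mem_of hV _ _) (inv_mem (hol_mem_of hV _ _))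
  have hWiu : W₀⁻¹ ∈ unitaryUnits 𝕄 := (unitaryUnits 𝕄).inv_mem hWu
  have hz : ‖mlog (W₀ : 𝕄)‖ ≤ 2 * ‖(W₀ : 𝕄) - 1‖ := norm_mlog_le_two_mul (by linarith)
  have hz1 : ‖mlog (W₀ : 𝕄)‖ ≤ 1 := by linarith
  have hAdn : ‖Ad W₀⁻¹ M‖ = ‖M‖ := norm_Ad_of_unitary hWiu _
  have hinv : ‖((W₀⁻¹ : 𝕄ˣ) : 𝕄) - 1‖ ≤ ‖(W₀ : 𝕄) - 1‖ := norm_inv_sub_one_le (mem_U1_of_unitary hWu)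
  have hE : ‖Ad W₀⁻¹ M - M‖ ≤ 2 * ‖(W₀ : 𝕄) - 1‖ * ‖M‖ :=
    (norm_Ad_sub_le hWiu _).trans (mul_le_mul_of_nonneg_right (mul_le_mul_of_nonneg_left hinv (by norm_num))
      (norm_nonneg _))
  have hD : ‖Z' - Ad W₀⁻¹ M‖ ≤ 15 * ‖mlog (W₀ : 𝕄)‖ * ‖Z'‖ := by
    have h := norm_jexp_sub_le (mlog (W₀ : 𝕄)) Z' hz1
    rwa [hid, norm_sub_rev] at h
  have hZle : ‖Z'‖ ≤ ‖M‖ + ‖Z' - Ad W₀⁻¹ M‖ := by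
    have h := norm_add_le (Ad W₀⁻¹ M) (Z' - Ad W₀⁻¹ M)
    rwa [add_sub_cancel, hAdn] at h
  have key := mlogDeriv_aux (norm_nonneg Z') (norm_nonneg _) hz hW hZle hD hE
  refine ⟨key.1, ?_⟩
  calc ‖Z' - M‖ ≤ ‖Z' - Ad W₀⁻¹ M‖ + ‖Ad W₀⁻¹ M - M‖ := norm_sub_le_norm_sub_add_norm_sub _ _ _
    _ ≤ 482 * ‖(W₀ : 𝕄) - 1‖ * ‖M‖ := key.2

/-! ## §3 The averaged bond variable `V̄(c) = e^{X_c}V(Γ_c)` along `V e^{sψ}` -/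

/-- The derivative of the exponent `X_c` of (42): `X_c′ = Σ_x L^{−d} (log W_{c,x})′`. [cite: Balaban1985Averaging, (42) p.23] -/
def XavgDeriv (L : ℕ) (V : Site d → Fin d → 𝕄ˣ) (ψ : Site d → Fin d → 𝕄) (q : Site d) (κ : Fin d) : 𝕄 :=
  ∑ r : Fin d → Fin L, (((L : ℝ) ^ d)⁻¹) • mlogDeriv L V ψ q κ (boxVec L r)

/-- `d/ds|₀ X_c[V_s] = X_c′` inside the ball. [cite: Balaban1985Averaging, (42) p.23] -/
theorem hasDerivAt_Xavg_vary (L : ℕ) (V : Site d → Fin d → 𝕄ˣ) (ψ : Site d → Fin d → 𝕄) (q : Site d) (κ : Fin d)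
    (hW : ∀ r : Fin d → Fin L, ‖((Wcx L V q κ (boxVec L r) : 𝕄ˣ) : 𝕄) - 1‖ < 1) :
    HasDerivAt (fun s : ℝ => Xavg L (vary V ψ s) q κ) (XavgDeriv L V ψ q κ) 0 := by
  unfold Xavg XavgDeriv
  exact HasDerivAt.fun_sum fun r _ => (hasDerivAt_mlog_Wcx_vary L V ψ q κ r (hW r)).const_smul (((L : ℝ) ^ d)⁻¹)

/-- **THE LEFT-TRIVIALISED DERIVATIVE OF ONE AVERAGED BOND**: `δV̄(c) := Ad_{e^{X_c}}(J_{X_c}(X_c′) + (δ_ψV)(Γ_c))`.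
[cite: Balaban1985Averaging, (42) p.23] -/
def sideDeriv (L : ℕ) (V : Site d → Fin d → 𝕄ˣ) (ψ : Site d → Fin d → 𝕄) (q : Site d) (κ : Fin d) : 𝕄 :=
  Ad (expUnit (Xavg L V q κ)) (jexp (Xavg L V q κ) (XavgDeriv L V ψ q κ) + dhol V ψ q (seg κ L))

/-- **`d/ds|₀ V̄_s(c) = δV̄(c) · V̄(c)`** (product rule: Duhamel for `e^{X_c}`, transport for `V(Γ_c)`).
[cite: Balaban1985Averaging, (42) p.23] -/
theorem hasDerivAt_val_bavg_vary (L : ℕ) (V : Site d → Fin d → 𝕄ˣ) (ψ : Site d → Fin d → 𝕄) (q : Site d)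
    (κ : Fin d) (hW : ∀ r : Fin d → Fin L, ‖((Wcx L V q κ (boxVec L r) : 𝕄ˣ) : 𝕄) - 1‖ < 1) :
    HasDerivAt (fun s : ℝ => ((bavg L (vary V ψ s) q κ : 𝕄ˣ) : 𝕄))
      (sideDeriv L V ψ q κ * ((bavg L V q κ : 𝕄ˣ) : 𝕄)) 0 := by
  have h1 := hasDerivAt_exp_comp_jexp (hasDerivAt_Xavg_vary L V ψ q κ hW)
  have h2 := hasDerivAt_val_hol_vary_word V ψ (seg κ L) q
  have h := h1.mul h2
  simp only [vary_zero] at h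
  have e1 : (fun s : ℝ => ((bavg L (vary V ψ s) q κ : 𝕄ˣ) : 𝕄))
      = fun s : ℝ => exp (Xavg L (vary V ψ s) q κ) * ((hol (vary V ψ s) q (seg κ L) : 𝕄ˣ) : 𝕄) := by
    funext s; simp only [bavg, Units.val_mul, val_expUnit]
  rw [e1]
  refine h.congr_deriv ?_
  simp only [sideDeriv, bavg, Units.val_mul, val_expUnit, Ad, val_inv_expUnit]
  -- `e^X J H + e^X (δH · H) = (e^X (J + δH) e^{−X}) · (e^X H)`
  have hexp : exp (-Xavg L V q κ) * exp (Xavg L V q κ) = 1 := by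
    have h := (expUnit (Xavg L V q κ)).inv_mul
    rwa [val_inv_expUnit, val_expUnit] at h
  calc exp (Xavg L V q κ) * jexp (Xavg L V q κ) (XavgDeriv L V ψ q κ) * ((hol V q (seg κ L) : 𝕄ˣ) : 𝕄)
        + exp (Xavg L V q κ) * (dhol V ψ q (seg κ L) * ((hol V q (seg κ L) : 𝕄ˣ) : 𝕄))
      = exp (Xavg L V q κ) * (jexp (Xavg L V q κ) (XavgDeriv L V ψ q κ) + dhol V ψ q (seg κ L))
          * (exp (-Xavg L V q κ) * exp (Xavg L V q κ)) * ((hol V q (seg κ L) : 𝕄ˣ) : 𝕄) := by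
        rw [hexp]; noncomm_ring
    _ = _ := by noncomm_ring

/-- The exponent `X_c` is skew-adjoint on `U(N)` data (all loop variables within `1/4` of `1`). [cite: Balaban1985Averaging, (22)–(23) p.21, (42) p.23] -/
theorem Xavg_mem_skewAdjoint (L : ℕ) {V : Site d → Fin d → 𝕄ˣ} (hV : IsUnitaryCfg V) (q : Site d) (κ : Fin d)
    (hW : ∀ r : Fin d → Fin L, ‖((Wcx L V q κ (boxVec L r) : 𝕄ˣ) : 𝕄) - 1‖ ≤ 1 / 4) :
    Xavg L V q κ ∈ skewAdjoint 𝕄 := by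
  letI : CStarAlgebra 𝕄 := {}
  unfold Xavg
  refine sum_mem fun r _ => skewAdjoint.smul_mem _ ?_
  rw [skewAdjoint.mem_iff]
  have hWm : ((Wcx L V q κ (boxVec L r) : 𝕄ˣ) : 𝕄) ∈ unitary 𝕄 :=
    (unitaryUnits 𝕄).mul_mem (hol_mem_of hV _ _) ((unitaryUnits 𝕄).inv_mem (hol_mem_of hV _ _))
  exact star_mlog_eq_neg hWm (hW r)

/-- `e^{X_c}` is unitary. [folklore] -/
theorem expUnit_Xavg_mem_unitary (L : ℕ) {V : Site d → Fin d → 𝕄ˣ} (hV : IsUnitaryCfg V) (q : Site d) (κ : Fin d)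
    (hW : ∀ r : Fin d → Fin L, ‖((Wcx L V q κ (boxVec L r) : 𝕄ˣ) : 𝕄) - 1‖ ≤ 1 / 4) :
    expUnit (Xavg L V q κ) ∈ unitaryUnits 𝕄 := by
  letI : NormedAlgebra ℚ 𝕄 := NormedAlgebra.restrictScalars ℚ ℝ 𝕄
  rw [mem_unitaryUnits, val_expUnit]
  exact NormedSpace.exp_mem_unitary_of_mem_skewAdjoint (Xavg_mem_skewAdjoint L hV q κ hW)

/-- `‖X_c‖ ≤ 2·max_x‖W_{c,x} − 1‖` (average of logarithms). [folklore] -/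
theorem norm_Xavg_le (L : ℕ) (hL : 1 ≤ L) (V : Site d → Fin d → 𝕄ˣ) (q : Site d) (κ : Fin d) {w : ℝ}
    (hw : w ≤ 1 / 2) (hW : ∀ r : Fin d → Fin L, ‖((Wcx L V q κ (boxVec L r) : 𝕄ˣ) : 𝕄) - 1‖ ≤ w) :
    ‖Xavg L V q κ‖ ≤ 2 * w := by
  unfold Xavg
  refine norm_avg_le L hL _ fun r => ?_
  have h := norm_mlog_le_two_mul (X := ((Wcx L V q κ (boxVec L r) : 𝕄ˣ) : 𝕄)) ((hW r).trans hw)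
  linarith [hW r]

/-- THE LINEARISED SIDE DERIVATIVE (still dressed): `Σ_x L^{−d}(δ_ψV)(loop_{c,x}) + (δ_ψV)(Γ_c)`. [folklore] -/
def sideDerivLin (L : ℕ) (V : Site d → Fin d → 𝕄ˣ) (ψ : Site d → Fin d → 𝕄) (q : Site d) (κ : Fin d) : 𝕄 :=
  ∑ r : Fin d → Fin L, (((L : ℝ) ^ d)⁻¹) • dhol V ψ q (loopWord L κ (boxVec L r)) + dhol V ψ q (seg κ L)

/-- The averaged loop weight `Σ_x L^{−d}‖(δ_ψV)(loop_{c,x})‖`. [folklore] -/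
def loopAvg (L : ℕ) (V : Site d → Fin d → 𝕄ˣ) (ψ : Site d → Fin d → 𝕄) (q : Site d) (κ : Fin d) : ℝ :=
  ∑ r : Fin d → Fin L, ((L : ℝ) ^ d)⁻¹ * ‖dhol V ψ q (loopWord L κ (boxVec L r))‖

/-- `loopAvg ≥ 0`. [folklore] -/
theorem loopAvg_nonneg (L : ℕ) (V : Site d → Fin d → 𝕄ˣ) (ψ : Site d → Fin d → 𝕄) (q : Site d) (κ : Fin d) :
    0 ≤ loopAvg L V ψ q κ := Finset.sum_nonneg fun _ _ => mul_nonneg (by positivity) (norm_nonneg _)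

/-- `e^t − 1 ≤ 2t` on `[0,1]`. [folklore] -/
private theorem exp_sub_one_le_two_mul {t : ℝ} (h0 : 0 ≤ t) (h1 : t ≤ 1) : Real.exp t - 1 ≤ 2 * t := by
  have h := Real.abs_exp_sub_one_sub_id_le (by rw [abs_of_nonneg h0]; exact h1)
  have h' := (abs_le.mp h).2
  nlinarith

set_option maxHeartbeats 800000 in
/-- **(DL), ONE SIDE**: on `U(N)` data with every loop variable within `w ≤ 1/32` of `1`,
`‖δV̄(c) − [Σ_x L^{−d}(δ_ψV)(loop_{c,x}) + (δ_ψV)(Γ_c)]‖ ≤ 1250·w·(Σ_x L^{−d}‖δ loop_{c,x}‖ + ‖δΓ_c‖)` and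
`‖δV̄(c)‖ ≤ 32·Σ_x L^{−d}‖δ loop‖ + ‖δΓ_c‖`. [cite: Balaban1985Averaging, (42) p.23, p.28] -/
theorem norm_sideDeriv_sub_lin_le [Nonempty n] (L : ℕ) (hL : 1 ≤ L) {V : Site d → Fin d → 𝕄ˣ} (hV : IsUnitaryCfg V)
    (ψ : Site d → Fin d → 𝕄) (q : Site d) (κ : Fin d) {w : ℝ} (hw : w ≤ 1 / 32)
    (hW : ∀ r : Fin d → Fin L, ‖((Wcx L V q κ (boxVec L r) : 𝕄ˣ) : 𝕄) - 1‖ ≤ w) :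
    ‖sideDeriv L V ψ q κ - sideDerivLin L V ψ q κ‖
        ≤ 1250 * w * (loopAvg L V ψ q κ + ‖dhol V ψ q (seg κ L)‖) ∧
      ‖sideDeriv L V ψ q κ‖ ≤ 32 * loopAvg L V ψ q κ + ‖dhol V ψ q (seg κ L)‖ := by
  have hw0 : 0 ≤ w := (norm_nonneg _).trans (hW (fun _ => ⟨0, hL⟩))
  have hW4 : ∀ r : Fin d → Fin L, ‖((Wcx L V q κ (boxVec L r) : 𝕄ˣ) : 𝕄) - 1‖ ≤ 1 / 4 := fun r =>
    (hW r).trans (hw.trans (by norm_num))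
  have hW32 : ∀ r : Fin d → Fin L, ‖((Wcx L V q κ (boxVec L r) : 𝕄ˣ) : 𝕄) - 1‖ ≤ 1 / 32 := fun r =>
    (hW r).trans hw
  set X := Xavg L V q κ with hX
  set X' := XavgDeriv L V ψ q κ with hX'
  set H' := dhol V ψ q (seg κ L) with hH'
  set A := loopAvg L V ψ q κ with hA
  have hA0 : 0 ≤ A := loopAvg_nonneg L V ψ q κ
  have hH0 := norm_nonneg H'
  -- `‖X‖ ≤ 2w`
  have hXn : ‖X‖ ≤ 2 * w := norm_Xavg_le L hL V q κ (hw.trans (by norm_num)) hW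
  have hX1 : ‖X‖ ≤ 1 := by linarith
  -- `‖X′‖ ≤ 16 A`, `‖X′ − Σ L^{-d} δloop‖ ≤ 482 w A`
  have hX'n : ‖X'‖ ≤ 16 * A := by
    rw [hX', hA]
    unfold XavgDeriv loopAvg
    refine (norm_sum_le _ _).trans ?_
    rw [show (16 : ℝ) * ∑ r : Fin d → Fin L, ((L : ℝ) ^ d)⁻¹ * ‖dhol V ψ q (loopWord L κ (boxVec L r))‖
      = ∑ r : Fin d → Fin L, ((L : ℝ) ^ d)⁻¹ * (16 * ‖dhol V ψ q (loopWord L κ (boxVec L r))‖) by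
      rw [Finset.mul_sum]; refine Finset.sum_congr rfl fun r _ => ?_; ring]
    refine Finset.sum_le_sum fun r _ => ?_
    rw [norm_smul, Real.norm_of_nonneg (by positivity)]
    exact mul_le_mul_of_nonneg_left (norm_mlogDeriv_sub_le L hV ψ q κ r (hW32 r)).1 (by positivity)
  have hX's : ‖X' - ∑ r : Fin d → Fin L, (((L : ℝ) ^ d)⁻¹) • dhol V ψ q (loopWord L κ (boxVec L r))‖
      ≤ 482 * w * A := by
    rw [hX', hA]
    unfold XavgDeriv loopAvg
    rw [← Finset.sum_sub_distrib]
    refine (norm_sum_le _ _).trans ?_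
    rw [Finset.mul_sum]
    refine Finset.sum_le_sum fun r _ => ?_
    rw [← smul_sub, norm_smul, Real.norm_of_nonneg (by positivity)]
    have h := (norm_mlogDeriv_sub_le L hV ψ q κ r (hW32 r)).2
    calc ((L : ℝ) ^ d)⁻¹ * ‖mlogDeriv L V ψ q κ (boxVec L r) - dhol V ψ q (loopWord L κ (boxVec L r))‖
        ≤ ((L : ℝ) ^ d)⁻¹ * (482 * ‖((Wcx L V q κ (boxVec L r) : 𝕄ˣ) : 𝕄) - 1‖
            * ‖dhol V ψ q (loopWord L κ (boxVec L r))‖) := mul_le_mul_of_nonneg_left h (by positivity)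
      _ ≤ ((L : ℝ) ^ d)⁻¹ * (482 * w * ‖dhol V ψ q (loopWord L κ (boxVec L r))‖) :=
          mul_le_mul_of_nonneg_left (mul_le_mul_of_nonneg_right
            (mul_le_mul_of_nonneg_left (hW r) (by norm_num)) (norm_nonneg _)) (by positivity)
      _ = 482 * w * (((L : ℝ) ^ d)⁻¹ * ‖dhol V ψ q (loopWord L κ (boxVec L r))‖) := by ring
  -- `‖J_X(X′) − X′‖ ≤ 15‖X‖‖X′‖`, `‖J_X(X′)‖ ≤ e^{2‖X‖}‖X′‖ ≤ 2·16A`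
  have hJs : ‖jexp X X' - X'‖ ≤ 15 * ‖X‖ * ‖X'‖ := norm_jexp_sub_le X X' hX1
  have hexp2 : Real.exp (2 * ‖X‖) ≤ 2 := by
    have h1 : 2 * ‖X‖ ≤ 1 / 8 := by linarith
    have h2 := exp_sub_one_le_two_mul (by positivity : 0 ≤ 2 * ‖X‖) (by linarith)
    linarith
  have hJn : ‖jexp X X'‖ ≤ 32 * A :=
    calc ‖jexp X X'‖ ≤ Real.exp (2 * ‖X‖) * ‖X'‖ := norm_jexp_le X X'
      _ ≤ 2 * (16 * A) := mul_le_mul hexp2 hX'n (norm_nonneg _) (by norm_num)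
      _ = 32 * A := by ring
  -- `‖Ad_{e^X} Y − Y‖ ≤ 2‖e^X − 1‖‖Y‖`, `‖e^X − 1‖ ≤ e^{‖X‖} − 1 ≤ 2‖X‖ ≤ 4w`
  set Y := jexp X X' + H' with hY
  have hYn : ‖Y‖ ≤ 32 * A + ‖H'‖ := (norm_add_le _ _).trans (add_le_add hJn le_rfl)
  have hUe : expUnit X ∈ unitaryUnits 𝕄 := expUnit_Xavg_mem_unitary L hV q κ hW4
  have hE1 : ‖((expUnit X : 𝕄ˣ) : 𝕄) - 1‖ ≤ 4 * w := by
    rw [val_expUnit]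
    letI : NormedAlgebra ℚ 𝕄 := NormedAlgebra.restrictScalars ℚ ℝ 𝕄
    calc ‖exp X - 1‖ ≤ Real.exp ‖X‖ - 1 := Literature.Analysis.Calculus.norm_exp_sub_one_le X
      _ ≤ 2 * ‖X‖ := exp_sub_one_le_two_mul (norm_nonneg _) hX1
      _ ≤ 4 * w := by linarith
  have hAd : ‖Ad (expUnit X) Y - Y‖ ≤ 2 * (4 * w) * (32 * A + ‖H'‖) :=
    calc _ ≤ 2 * ‖((expUnit X : 𝕄ˣ) : 𝕄) - 1‖ * ‖Y‖ := norm_Ad_sub_le hUe Y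
      _ ≤ 2 * (4 * w) * (32 * A + ‖H'‖) :=
          mul_le_mul (mul_le_mul_of_nonneg_left hE1 (by norm_num)) hYn (norm_nonneg _) (by positivity)
  -- assemble
  have hsd : sideDeriv L V ψ q κ = Ad (expUnit X) Y := rfl
  have hlin : sideDerivLin L V ψ q κ = ∑ r : Fin d → Fin L, (((L : ℝ) ^ d)⁻¹) • dhol V ψ q (loopWord L κ (boxVec L r)) + H' :=
    rfl
  refine ⟨?_, ?_⟩
  · have e1 : sideDeriv L V ψ q κ - sideDerivLin L V ψ q κ
        = (Ad (expUnit X) Y - Y) + (jexp X X' - X')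
          + (X' - ∑ r : Fin d → Fin L, (((L : ℝ) ^ d)⁻¹) • dhol V ψ q (loopWord L κ (boxVec L r))) := by
      rw [hsd, hlin, hY]; abel
    rw [e1]
    calc _ ≤ ‖Ad (expUnit X) Y - Y‖ + ‖jexp X X' - X'‖
          + ‖X' - ∑ r : Fin d → Fin L, (((L : ℝ) ^ d)⁻¹) • dhol V ψ q (loopWord L κ (boxVec L r))‖ := norm_add₃_le
      _ ≤ 2 * (4 * w) * (32 * A + ‖H'‖) + 15 * ‖X‖ * ‖X'‖ + 482 * w * A := add_le_add (add_le_add hAd hJs) hX's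
      _ ≤ 2 * (4 * w) * (32 * A + ‖H'‖) + 15 * (2 * w) * (16 * A) + 482 * w * A :=
          add_le_add (add_le_add le_rfl (mul_le_mul (mul_le_mul_of_nonneg_left hXn (by norm_num)) hX'n
            (norm_nonneg _) (by positivity))) le_rfl
      _ = 1218 * (w * A) + 8 * (w * ‖H'‖) := by ring
      _ ≤ 1250 * (w * A) + 1250 * (w * ‖H'‖) := by
          have h1 := mul_nonneg hw0 hA0; have h2 := mul_nonneg hw0 hH0; linarith
      _ = 1250 * w * (A + ‖H'‖) := by ring
  · rw [hsd, norm_Ad_of_unitary hUe]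
    exact hYn

end

end Summit.QuantumFields.BalabanUV.T4Continuum.AveragingDeficitSideDeriv
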